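import Summits.FinalStateConjecture.FinalStateConjecture.Theorems.ClusterCompletenessOmegaLimitMultiKerrBackgroundOmegaLimits
import Summits.FinalStateConjecture.FinalStateConjecture.Theorems.ClusterCompletenessOmegaLimitMultiKerrTranslates
import Literature.Geometry.Lorentzian.MultiCentreRadiationZone
import HarnessLib

/-!
# Route ClusterCompleteness · crux `OmegaLimitMultiKerr` — `Cᵏ_loc` ω-limits of tame HOLE CHARTS
# on boosted Kerr backgrounds, and their flatness along recurrence sequences

Structure lemmas for the crux stmt-FinalStateConjecture-14664
(`ClusterCompleteness.OmegaLimitMultiKerr`, rank 9), line `Sketch`, lead gen 3: the ω-limit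
dictionary of `ClusterCompletenessOmegaLimitMultiKerrBackgroundOmegaLimits` (abstract
`ModelBackground` with a translation vector) SPECIALISED to the hole charts that the recur-disjunct
`Recurs k 𝒟` (`ClusterCompletenessOmegaLimitMultiKerrDefs`) consumes: a chart `Ψ` on
`B = boostedKerrBackground Λ c M a`, translated along the Killing vector `e = Λ∂₀`
(`x ↦ x + s • e` preserves the boosted exterior, the rest-frame radius and `g_{M,a}`, and shifts the
chart time `t*` by `s`; `ClusterCompletenessOmegaLimitMultiKerrTranslates`).

* `exists_omegaLimit_hole_translate` (the registered stub, closed form) — if `Ψ` is smooth and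
  TAME after `τ₀` (the `C^{k+1}` sup norm of the deviation `Ψ^* g − g_{M,a}` over every truncated
  late region `{t* > τ₀, r ≤ R}` is finite), then along EVERY sequence of chart times `T n → +∞` a
  subsequence of the translates `x ↦ (Ψ^* g − g_{M,a})(x + T (φ n) • e)` converges in `Cᵏ` on
  every compact subset of the boosted exterior to a `Cᵏ` field `g` — an ω-limit of the hole chart
  along `T` (step (i) "ω-limits exist" of the LaSalle reading of the crux, idea card
  `lasalle-lands-on-liminf`; Hale 1980, Ch. I, §8; the compactness is the `Cᵏ` Arzelà–Ascoli
  theorem, Petersen 2006, Ch. 10, §3.1, in the form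
  `exists_omegaLimit_translate_of_bounded_truncLateRegion`).
* `iteratedFDeriv_hole_omegaLimit_eq_zero_of_tendsto_truncDeviationCk` — if moreover the chart
  RECURS along `T` at every radius (`truncDeviationCk B Ψ k R' (T n) → 0` for all `R'`, the hole
  clause of the sequential form of `Recurs k 𝒟`), then EVERY such ω-limit `g` along `T` is flat to
  order `k` on the time-zero slab `{t* = 0}` (all derivatives of order `≤ k` vanish there): the
  recurrence clause read through `truncDeviationCk_eq_supCkENorm_translate` is `Cᵏ`-smallness of
  the translates on the time-zero truncated slabs, and
  `iteratedFDeriv_omegaLimit_eq_zero_of_tendsto_supCkENorm_truncTimeSlab` applies.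
* `hole_omegaLimit_flat_of_recurrence` — the two combined: a tame hole chart that recurs along
  `T n → ∞` has, along a subsequence of `T`, a `Cᵏ_loc` ω-limit which is flat to order `k` on
  `{t* = 0}` (the necessity half of step (iii) "recurrence = the reference configuration is an
  ω-limit point").
* `exists_omegaLimit_flat_translate` — the flat-chart (`N = 0`, radiation-zone) analogue of the
  first item: a smooth chart `Ψ₀` on `Minkowski.backgroundOn U₀` with `U₀ ⊇ {x⁰ > τ₀}` whose
  deviation `Ψ₀^* g − η` has finite `C^{k+1}` sup norm over every `{x⁰ > τ₀, |x̲| ≤ R}` has, along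
  every `T n → ∞`, a subsequence of `∂₀`-translates converging in `Cᵏ` on compacts of the half-space
  `{x⁰ > τ₀}`; the half-space is only FORWARD invariant, so this goes through
  `exists_strictMono_tendsto_supCkENorm_translate_sub` directly (times `max (T n) 0`).

Known asymmetry (for the re-line): the converse "flat ω-limit on `{t* = 0}` ⇒ recurrence at every
radius" only holds on COMPACT subsets of the exterior
(`tendsto_supCkENorm_translate_of_iteratedFDeriv_omegaLimit_eq_zero`): the truncated slab
`{t* = 0, r₊ < r ≤ R'}` is not compact in the open exterior — it accumulates at the horizon boundary
`{r = r₊}` — so `Cᵏ_loc` convergence does not control `truncDeviationCk … R'`. Era charts with a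
margin `{r > r₊ − δ}` across the horizon (or recurrence measured on `{r₊ + δ ≤ r ≤ R'}`) restore the
equivalence. The same applies to the flat chart, whose recurrence clause `deviationCk … k (T n) → 0`
is measured on the full (non-compact) slabs `{x⁰ = T n} ∩ U₀`.

Everything is proved; Mathlib + `Literature` + the landed `Theorems` files only.
-/

-- every `Summit.FinalStateConjecture.FinalStateConjecture.…` name repeats the summit = sub-problem segment (D-0017 layout)
set_option linter.dupNamespace false

noncomputable section

open scoped Manifold ContDiff Topology ENNReal
open Set Filter TopologicalSpace

namespace Summit.FinalStateConjecture.FinalStateConjecture.Theorems.ClusterCompleteness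

open Literature.Geometry.Lorentzian

/-! ### ω-limits of a tame hole chart exist along every sequence of chart times -/

/-- **Registered structure stub (crux stmt-FinalStateConjecture-14664, line `Sketch`): tame hole
charts have `Cᵏ_loc` ω-limits along every `T n → ∞`.** Let `Ψ` be a smooth chart on the boosted Kerr
background `B = boostedKerrBackground Λ c M a` whose deviation `Ψ^* g − g_{M,a}` (extended by zero)
has FINITE `C^{k+1}` sup norm over every truncated late region `{t* > τ₀, r ≤ R}` (tameness after
`τ₀`). Then for every sequence of chart times `T n → +∞` there are a `Cᵏ` field `g` on the boosted
exterior and a subsequence `φ` along which the translates `x ↦ (Ψ^* g − g_{M,a})(x + T (φ n) • Λ∂₀)`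
converge to `g` in `Cᵏ` on every compact subset of the exterior. Specialisation of
`exists_omegaLimit_translate_of_bounded_truncLateRegion`: the exterior is `Λ∂₀`-invariant
(`add_smul_mem_boostedKerrBackground_domain`), `t*` is shifted and `r` preserved
(`KerrSchildChart.time_add_smul / radius_add_smul`), both are continuous, the deviation is `C^∞` on
the exterior (`contDiffOn_deviationExtend_boostedKerr`), and a finite `supCkENorm` gives pointwise
bounds (`norm_iteratedFDeriv_le_toReal_supCkENorm`). Hale 1980, Ch. I, §8 (bounded orbits have
nonempty ω-limit sets); Petersen 2006, Ch. 10, §3.1 (`Cᵏ` Arzelà–Ascoli). Closed form.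
[cite: Petersen2006, Ch. 10 §3.1] -/
theorem exists_omegaLimit_hole_translate :
    ∀ (𝓢 : Spacetime 4) (Λ : lorentzGroup) (c : E4) (M a : ℝ)
      (Ψ : (boostedKerrBackground Λ c M a).domain → 𝓢.carrier),
      ContMDiff 𝓘(ℝ, E4) (𝓡 4) ∞ Ψ →
      ∀ {k : ℕ} {τ₀ : ℝ}, (∀ R : ℝ,
        supCkENorm (Subtype.val '' (boostedKerrBackground Λ c M a).truncLateRegion τ₀ R) (k + 1)
          (𝓢.deviationExtend (boostedKerrBackground Λ c M a) Ψ) ≠ ⊤) →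
      ∀ {T : ℕ → ℝ}, Tendsto T atTop atTop →
      ∃ (g : E4 → E4 →L[ℝ] E4 →L[ℝ] ℝ) (φ : ℕ → ℕ), StrictMono φ ∧
        ContDiffOn ℝ k g (boostedKerrExterior Λ c M a : Set E4) ∧
        ∀ K ⊆ (boostedKerrExterior Λ c M a : Set E4), IsCompact K →
          Tendsto (fun n ↦ supCkENorm K k (fun x ↦
            𝓢.deviationExtend (boostedKerrBackground Λ c M a) Ψ
              (x + T (φ n) • (Λ : E4 ≃L[ℝ] E4) (EuclideanSpace.single (0 : Fin 4) (1 : ℝ))) -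
              g x)) atTop (𝓝 0) := by
  intro 𝓢 Λ c M a Ψ hΨ k τ₀ hfin T hT
  -- continuity of the rest-frame chart time `t*(x) = (Λ⁻¹(x − c))⁰` and radius `r(Λ⁻¹(x − c))`
  have htc : Continuous (boostedKerrBackground Λ c M a).time :=
    (PiLp.continuous_apply 2 _ 0).comp (continuous_poincareInv Λ c)
  have hrc : Continuous (boostedKerrBackground Λ c M a).radius :=
    (Kerr.continuous_radius a).comp (continuous_poincareInv Λ c)
  -- the deviation of a smooth chart is `C^∞`, hence `C^{k+1}`, on the boosted exterior
  have hh : ContDiffOn ℝ (k + 1) (𝓢.deviationExtend (boostedKerrBackground Λ c M a) Ψ)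
      ((boostedKerrBackground Λ c M a).domain : Set E4) :=
    (contDiffOn_deviationExtend_boostedKerr 𝓢 hΨ).of_le (by exact_mod_cast le_top)
  -- tameness: pointwise bounds on the truncated late regions from the finite `C^{k+1}` sup norms
  have hb : ∀ R : ℝ, ∃ C : ℝ, ∀ i, i ≤ k + 1 →
      ∀ x ∈ Subtype.val '' (boostedKerrBackground Λ c M a).truncLateRegion τ₀ R,
        ‖iteratedFDeriv ℝ i (𝓢.deviationExtend (boostedKerrBackground Λ c M a) Ψ) x‖ ≤ C :=
    fun R ↦ ⟨_, fun _ hi _ hx ↦ norm_iteratedFDeriv_le_toReal_supCkENorm hi hx _ (hfin R)⟩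
  exact exists_omegaLimit_translate_of_bounded_truncLateRegion (boostedKerrBackground Λ c M a)
    ((Λ : E4 ≃L[ℝ] E4) (EuclideanSpace.single (0 : Fin 4) (1 : ℝ)))
    (add_smul_mem_boostedKerrBackground_domain Λ c M a) (KerrSchildChart.time_add_smul Λ c M a)
    (KerrSchildChart.radius_add_smul Λ c M a) htc hrc hh hb hT

/-! ### Along a recurrence sequence every ω-limit is flat on the time-zero slab -/

/-- **Recurrence of a hole chart along `T` forces every ω-limit along `T` to be flat to order `k`
on `{t* = 0}`.** Let `Ψ` be a smooth chart on `boostedKerrBackground Λ c M a`, `g` a `Cᵏ` field on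
the boosted exterior, and `T n` chart times along which the translates
`x ↦ (Ψ^* g − g_{M,a})(x + T n • Λ∂₀)` converge to `g` in `Cᵏ` on every compact subset of the
exterior. If the chart RECURS along `T` at every radius — the truncated `Cᵏ` deviations
`truncDeviationCk B Ψ k R' (T n)` tend to `0` for every `R'` (the hole clause of the sequential form
of `Recurs k 𝒟`) — then all derivatives of `g` of order `≤ k` vanish on the slab `{t* = 0}`.
The recurrence clause is, by `truncDeviationCk_eq_supCkENorm_translate`, `Cᵏ`-smallness of the
translates on the time-zero truncated slabs, so
`iteratedFDeriv_omegaLimit_eq_zero_of_tendsto_supCkENorm_truncTimeSlab` applies (LaSalle reading: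
the reference configuration is an ω-limit POINT; Hale 1980, Ch. I, §8).
[cite: Hale1980, Ch. I §8] -/
theorem iteratedFDeriv_hole_omegaLimit_eq_zero_of_tendsto_truncDeviationCk (𝓢 : Spacetime 4)
    (Λ : lorentzGroup) (c : E4) (M a : ℝ) {Ψ : (boostedKerrBackground Λ c M a).domain → 𝓢.carrier}
    (hΨ : ContMDiff 𝓘(ℝ, E4) (𝓡 4) ∞ Ψ) {k : ℕ} {g : E4 → E4 →L[ℝ] E4 →L[ℝ] ℝ}
    (hg : ContDiffOn ℝ k g (boostedKerrExterior Λ c M a : Set E4)) {T : ℕ → ℝ}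
    (hlim : ∀ K ⊆ (boostedKerrExterior Λ c M a : Set E4), IsCompact K →
      Tendsto (fun n ↦ supCkENorm K k (fun x ↦
        𝓢.deviationExtend (boostedKerrBackground Λ c M a) Ψ
          (x + T n • (Λ : E4 ≃L[ℝ] E4) (EuclideanSpace.single (0 : Fin 4) (1 : ℝ))) - g x))
        atTop (𝓝 0))
    (hrec : ∀ R' : ℝ, Tendsto (fun n ↦
      𝓢.truncDeviationCk (boostedKerrBackground Λ c M a) Ψ k R' (T n)) atTop (𝓝 0)) :
    ∀ x ∈ Subtype.val '' (boostedKerrBackground Λ c M a).timeSlab 0, ∀ m, m ≤ k →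
      iteratedFDeriv ℝ m g x = 0 := by
  -- the deviation of a smooth chart is `C^{k+1}` on the boosted exterior
  have hh : ContDiffOn ℝ (k + 1) (𝓢.deviationExtend (boostedKerrBackground Λ c M a) Ψ)
      ((boostedKerrBackground Λ c M a).domain : Set E4) :=
    (contDiffOn_deviationExtend_boostedKerr 𝓢 hΨ).of_le (by exact_mod_cast le_top)
  -- recurrence along `T` = `Cᵏ`-smallness of the `T n`-translates on the time-zero truncated slabs
  have hrec' : ∀ R' : ℝ, Tendsto (fun n ↦
      supCkENorm (Subtype.val '' (boostedKerrBackground Λ c M a).truncTimeSlab R' 0) k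
        (fun x ↦ 𝓢.deviationExtend (boostedKerrBackground Λ c M a) Ψ
          (x + T n • (Λ : E4 ≃L[ℝ] E4) (EuclideanSpace.single (0 : Fin 4) (1 : ℝ)))))
      atTop (𝓝 0) := fun R' ↦
    (hrec R').congr fun n ↦ truncDeviationCk_eq_supCkENorm_translate 𝓢 Λ c M a Ψ k R' (T n)
  exact iteratedFDeriv_omegaLimit_eq_zero_of_tendsto_supCkENorm_truncTimeSlab
    (boostedKerrBackground Λ c M a)
    ((Λ : E4 ≃L[ℝ] E4) (EuclideanSpace.single (0 : Fin 4) (1 : ℝ)))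
    (add_smul_mem_boostedKerrBackground_domain Λ c M a) hh hg hlim hrec'

/-- **A tame hole chart that recurs along `T n → ∞` has a flat ω-limit along `T`.** Let `Ψ` be a
smooth chart on `boostedKerrBackground Λ c M a`, tame after `τ₀` (finite `C^{k+1}` sup norm of the
deviation over every `{t* > τ₀, r ≤ R}`), and let `T n → +∞` be chart times along which it recurs at
every radius (`truncDeviationCk B Ψ k R' (T n) → 0` for all `R'`). Then there are a `Cᵏ` field `g`
on the boosted exterior and a subsequence `φ` such that the `T (φ n)`-translates of the deviation
converge to `g` in `Cᵏ` on every compact subset of the exterior AND `g` is flat to order `k` on the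
time-zero slab `{t* = 0}`: `exists_omegaLimit_hole_translate` followed by
`iteratedFDeriv_hole_omegaLimit_eq_zero_of_tendsto_truncDeviationCk` along `T ∘ φ` (LaSalle reading
of the recur-disjunct; Hale 1980, Ch. I, §8). [cite: Hale1980, Ch. I §8] -/
theorem hole_omegaLimit_flat_of_recurrence (𝓢 : Spacetime 4) (Λ : lorentzGroup) (c : E4)
    (M a : ℝ) {Ψ : (boostedKerrBackground Λ c M a).domain → 𝓢.carrier}
    (hΨ : ContMDiff 𝓘(ℝ, E4) (𝓡 4) ∞ Ψ) {k : ℕ} {τ₀ : ℝ}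
    (hfin : ∀ R : ℝ,
      supCkENorm (Subtype.val '' (boostedKerrBackground Λ c M a).truncLateRegion τ₀ R) (k + 1)
        (𝓢.deviationExtend (boostedKerrBackground Λ c M a) Ψ) ≠ ⊤)
    {T : ℕ → ℝ} (hT : Tendsto T atTop atTop)
    (hrec : ∀ R' : ℝ, Tendsto (fun n ↦
      𝓢.truncDeviationCk (boostedKerrBackground Λ c M a) Ψ k R' (T n)) atTop (𝓝 0)) :
    ∃ (g : E4 → E4 →L[ℝ] E4 →L[ℝ] ℝ) (φ : ℕ → ℕ), StrictMono φ ∧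
      ContDiffOn ℝ k g (boostedKerrExterior Λ c M a : Set E4) ∧
      (∀ K ⊆ (boostedKerrExterior Λ c M a : Set E4), IsCompact K →
        Tendsto (fun n ↦ supCkENorm K k (fun x ↦
          𝓢.deviationExtend (boostedKerrBackground Λ c M a) Ψ
            (x + T (φ n) • (Λ : E4 ≃L[ℝ] E4) (EuclideanSpace.single (0 : Fin 4) (1 : ℝ))) - g x))
          atTop (𝓝 0)) ∧
      ∀ x ∈ Subtype.val '' (boostedKerrBackground Λ c M a).timeSlab 0, ∀ m, m ≤ k →
        iteratedFDeriv ℝ m g x = 0 := by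
  obtain ⟨g, φ, hφ, hg, hlim⟩ := exists_omegaLimit_hole_translate 𝓢 Λ c M a Ψ hΨ hfin hT
  exact ⟨g, φ, hφ, hg, hlim,
    iteratedFDeriv_hole_omegaLimit_eq_zero_of_tendsto_truncDeviationCk 𝓢 Λ c M a hΨ hg hlim
      fun R' ↦ (hrec R').comp hφ.tendsto_atTop⟩

/-! ### The flat chart: ω-limits of the radiation-zone deviation on the late half-space -/

/-- **Tame flat charts have `Cᵏ_loc` ω-limits on the late half-space along every `T n → ∞`**
(the `N = 0` / radiation-zone analogue of `exists_omegaLimit_hole_translate`). Let `Ψ₀` be a smooth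
chart on the Minkowski background `Minkowski.backgroundOn U₀` whose domain contains the late
half-space `{x⁰ > τ₀}`, and suppose the deviation `Ψ₀^* g − η` (extended by zero) has finite
`C^{k+1}` sup norm over every truncated late region `{x⁰ > τ₀, |x̲| ≤ R}` of the background. Then
along every `T n → +∞` a subsequence of the translates `x ↦ (Ψ₀^* g − η)(x + T (φ n) • ∂₀)`
converges in `Cᵏ` on every compact subset of the half-space `{x⁰ > τ₀}` to a `Cᵏ` field `g` there.
The half-space is only FORWARD invariant under `x ↦ x + s • ∂₀` (`s ≥ 0`), so this is
`exists_strictMono_tendsto_supCkENorm_translate_sub` directly (times `max (T n) 0`, which agree with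
`T n` eventually): a compact `K ⊆ {x⁰ > τ₀}` has bounded `|x̲|`, its forward translates stay in one
truncated late region, the deviation is `C^∞` on `U₀` (`Spacetime.contDiffAt_deviationExtend_model`,
the reference form `η` being constant). Hale 1980, Ch. I, §8; Petersen 2006, Ch. 10, §3.1.
[cite: Petersen2006, Ch. 10 §3.1] -/
theorem exists_omegaLimit_flat_translate (𝓢 : Spacetime 4) (U₀ : Opens E4) {τ₀ : ℝ}
    (hU : {x : E4 | τ₀ < x 0} ⊆ (U₀ : Set E4))
    {Ψ₀ : (Minkowski.backgroundOn U₀).domain → 𝓢.carrier}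
    (hΨ₀ : ContMDiff 𝓘(ℝ, E4) (𝓡 4) ∞ Ψ₀) {k : ℕ}
    (hfin : ∀ R : ℝ,
      supCkENorm (Subtype.val '' (Minkowski.backgroundOn U₀).truncLateRegion τ₀ R) (k + 1)
        (𝓢.deviationExtend (Minkowski.backgroundOn U₀) Ψ₀) ≠ ⊤)
    {T : ℕ → ℝ} (hT : Tendsto T atTop atTop) :
    ∃ (g : E4 → E4 →L[ℝ] E4 →L[ℝ] ℝ) (φ : ℕ → ℕ), StrictMono φ ∧
      ContDiffOn ℝ k g {x : E4 | τ₀ < x 0} ∧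
      ∀ K ⊆ {x : E4 | τ₀ < x 0}, IsCompact K →
        Tendsto (fun n ↦ supCkENorm K k (fun x ↦
          𝓢.deviationExtend (Minkowski.backgroundOn U₀) Ψ₀ (x + T (φ n) • E4.basisVector 0) - g x))
          atTop (𝓝 0) := by
  have hO : IsOpen {x : E4 | τ₀ < x 0} := isOpen_lt continuous_const (PiLp.continuous_apply 2 _ 0)
  -- coordinates of the translates
  have h0 : ∀ (x : E4) (s : ℝ), (x + s • E4.basisVector 0) 0 = x 0 + s := fun x s ↦ by simp
  have hsp : ∀ (x : E4) (s : ℝ), E4.spatialNorm (x + s • E4.basisVector 0) = E4.spatialNorm x :=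
    fun x s ↦ by simp only [E4.spatialNorm, Kerr.spatial_add_smul_basisVector_zero]
  have hOw : ∀ x ∈ {x : E4 | τ₀ < x 0}, ∀ s : ℝ, 0 ≤ s →
      x + s • E4.basisVector 0 ∈ {x : E4 | τ₀ < x 0} := by
    intro x hx s hs
    show τ₀ < (x + s • E4.basisVector 0) 0
    rw [h0]
    exact lt_add_of_lt_of_nonneg hx hs
  -- the deviation of a smooth flat chart is `C^∞` on `U₀` (the reference form `η` is constant)
  have hdev : ContDiffOn ℝ ∞ (𝓢.deviationExtend (Minkowski.backgroundOn U₀) Ψ₀) (U₀ : Set E4) :=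
    fun z hz ↦ (𝓢.contDiffAt_deviationExtend_model (Minkowski.backgroundOn U₀) hΨ₀ ⟨z, hz⟩
      contDiffAt_const).contDiffWithinAt
  have hh : ContDiffOn ℝ (k + 1) (𝓢.deviationExtend (Minkowski.backgroundOn U₀) Ψ₀)
      {x : E4 | τ₀ < x 0} :=
    (hdev.mono hU).of_le (by exact_mod_cast le_top)
  -- nonnegative times agreeing with `T` eventually
  set T' : ℕ → ℝ := fun n ↦ max (T n) 0 with hT'def
  have hT'0 : ∀ n, 0 ≤ T' n := fun n ↦ le_max_right _ _
  have hTT' : ∀ᶠ n in atTop, T' n = T n := by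
    filter_upwards [hT.eventually_ge_atTop 0] with n hn
    exact max_eq_left hn
  -- all-time bounds: forward translates of a compact `K ⊆ {x⁰ > τ₀}` stay in `{x⁰ > τ₀, |x̲| ≤ R₀}`
  have hb' : ∀ K ⊆ {x : E4 | τ₀ < x 0}, IsCompact K → ∃ Λ : ℝ, ∀ᶠ n in atTop,
      ∀ i, i ≤ k + 1 → ∀ z ∈ K, ‖iteratedFDeriv ℝ i
        (𝓢.deviationExtend (Minkowski.backgroundOn U₀) Ψ₀) (z + T' n • E4.basisVector 0)‖ ≤ Λ := by
    intro K hKO hK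
    obtain ⟨R₀, hR₀⟩ :=
      hK.bddAbove_image (continuous_norm.comp E4.spatial.continuous).continuousOn
    refine ⟨_, Eventually.of_forall fun n i hi z hz ↦
      norm_iteratedFDeriv_le_toReal_supCkENorm hi ?_ _ (hfin R₀)⟩
    have hzO : z + T' n • E4.basisVector 0 ∈ {x : E4 | τ₀ < x 0} := hOw z (hKO hz) _ (hT'0 n)
    refine ⟨⟨z + T' n • E4.basisVector 0, hU hzO⟩, ⟨hzO, ?_⟩, rfl⟩
    show E4.spatialNorm (z + T' n • E4.basisVector 0) ≤ R₀
    rw [hsp]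
    exact hR₀ (mem_image_of_mem _ hz)
  obtain ⟨g, φ, hφ, hg, hlim⟩ :=
    exists_strictMono_tendsto_supCkENorm_translate_sub hO hOw hh hT'0 hb'
  refine ⟨g, φ, hφ, hg, fun K hKO hK ↦ ?_⟩
  have hev : ∀ᶠ n in atTop, T' (φ n) = T (φ n) := hφ.tendsto_atTop.eventually hTT'
  refine (hlim K hKO hK).congr' ?_
  filter_upwards [hev] with n hn
  rw [hn]

end Summit.FinalStateConjecture.FinalStateConjecture.Theorems.ClusterCompleteness

end
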